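import Summits.ValiantsHypothesis.ValiantsHypothesis.Theorems.KPlusLogSqLawTridiagonalRealStaticPumpSeed

/-!
# Route «KPlusLogSqLaw», crux `WeakLifting` (stmt-ValiantsHypothesis-19561) — REAL side of the tridiagonal sector:
# THE PUMP FROM AN ARBITRARY SEED, part 2 (rows) — «a certified seed at sizes `(k+3, k+4)` with `|R| + |T| = S` gives a static definite
# tridiagonal `(k+j+5) × (k+j+5)` monomial matrix with `≥ S + 2j + 2` distinct positive determinant zeros (`+1` in the positive orientation)»,
# i.e. `B m ≥ 2m + S − 2m₀` for all `m > m₀ = k + 4`; part 1 (`…PumpSeed`) has the mechanics `pump_succ` / `pump_moves` / `harvest_of_state`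

HONEST FRAMING.  Helper (`--supports stmt-ValiantsHypothesis-19561 --as helper`), seat val-sym-lift-p3 (g15), cell `pub-symmetroid`,
2026-08-28, in the continuant / typed currencies of the pump files (`…PumpStep`, `…PumpIter`, `…PumpHarvestPos/Neg`, `…PumpEven`, seat
val-sym-lift-p1 g12) and of the desk's α target of record (`staticTridiagonal_definite_posRoots_le`, lead R2102/R2114).  LOWER side only,
pure bookkeeping: NO new design, NO located zero, NO new seed.  The tree's `pump_iter` bundles the base state `(D₃, D₄)` (`|R| + |T| = 1`,
size `4`) with the induction, and `pump_iter_parity` repeats the whole induction to track the orientation; neither lets a DIFFERENT base be fed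
in.  This file factors the induction step out of `pump_iter` VERBATIM (same two realised moves `pump_move_I` / `pump_move_II`, same abstract
`pump_step`) and re-assembles the pump from an arbitrary seed:
* `pump_succ` — ONE MOVE FROM ANY STATE: if vertex exponents `e`, links `(b, f)`, an orientation `ρ = ±1`, signs `s`, `μ = −ρs` and sample data
  `P0 < x < x₁ < R < M < T < y < y₁ < P1` (actual points `ρ·z > 0`) satisfy the 17 clauses for `(z ↦ D_{k+3}(ρz), z ↦ D_{k+4}(ρz))` with
  `|R| + |T| = S`, then one hierarchical edge (type I if `ρ = 1`, type II if `ρ = −1`) gives data satisfying the 17 clauses for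
  `(D_{k+4}, D_{k+5})` with orientation `−ρ` and `|R'| + |T'| = S + 2`;
* `pump_moves` — `j` moves: orientation `(−1)^j ρ`, `|R| + |T| = S + 2j`, sizes `(k+j+3, k+j+4)` (recovers `pump_iter` AND `pump_iter_parity`
  from the base `pump_base₀`: `k = 0`, `S = 1`, `ρ = −1`);
* `harvest_of_state` — the harvest edge from any state: a strictly increasing list of `≥ S + 3` positive points (`≥ S + 4` when `ρ = 1`, the
  transition zero at the junction, `pump_harvest_pos₄`) along which `D_{k+5}` alternates;
* `exists_typed_of_alternation` — packaging of `(e, b, f, Λ)` as a matrix `of (fun i j => C (c i j) * X ^ (e i j))` of the typed currency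
  (`c`, `e` symmetric, `c = 0` off the band, diagonal coefficients `1`), any size;
* `row_of_seed` / `row_of_seed_pos` — **THE SEEDED PUMP**: from a certified seed `(k, S, ρ)` as above, for every `j` a STATIC DEFINITE symmetric
  tridiagonal `(k+j+5) × (k+j+5)` monomial matrix with at least `S + 2j + 2` distinct positive determinant zeros, and at least `S + 2j + 3` when
  `(−1)^j ρ = 1`; `le_law_of_seed` / `le_law_of_seed_pos` — the same against any admissible law `B` of the sector.
ACCOUNTING (val-sym-lift-p3 g14 memo GLUE-AND-SEEDS §3, now kernel): a seed of size `m₀ = k + 4` with invariant value `S` gives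
`B m ≥ 2m + S − 2m₀` for every `m > m₀` (one more at every other size).  The only seed in the tree is the pump's own base (`m₀ = 4`, `S = 1`:
`2m − 7` / `2m − 6`); a seed with `S = 2m₀ − 5` (root word `q p^r q^t p`, `r + t = 2m₀ − 3`, plus the sign clause) would give `2m − 5` / `2m − 4`
for all larger `m` through `row_of_seed` with no further analysis — none is claimed here (located census of this seat: no kernel design of the
α column is such a seed; best ties `S = 2m₀ − 7`).  Nothing here is an UPPER bound; nothing bears on `WeakLifting` / `TropicalB` (stmt-19771) in
their windows, on Conjecture B, on the Door-A registers, on `MatrixDescartes` (stmt-ValiantsHypothesis-18050) or on VP ≠ VNP.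
[mechanism: val-sym-lift-p3 g9's pump-and-harvest as kernelised by val-sym-lift-p1 g12; folklore analysis and continuants]
-/

-- `Summit.ValiantsHypothesis.ValiantsHypothesis.…` repeats a component by the D-0017 layout (single-conjunct summit); the name is mandated.
set_option linter.dupNamespace false
set_option autoImplicit false

namespace Summit.ValiantsHypothesis.ValiantsHypothesis.Theorems.KPlusLogSqLaw.StaticTridiagonalRealLadder

open Polynomial
open Summit.ValiantsHypothesis.ValiantsHypothesis.Theorems.ValuativeFlip (ctK ctPath ctPath_apply ctK_zero ctK_one ctK_add_two)

/-! ### Packaging in the typed currency -/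

/-- **Continuant data with an alternation list are a typed row**: if `D_n` of the design with diagonal `X^{e_t}` and links `b_t X^{f_t}` alternates
in sign along a strictly increasing list of positive points of length `≥ N + 1`, then the band tables give a STATIC DEFINITE symmetric tridiagonal
`n × n` monomial matrix `of (fun i j => C (c i j) * X ^ (e i j))` of the desk's typed currency (`c`, `e` symmetric, `c = 0` off the band, diagonal
coefficients `1 > 0`) with at least `N` distinct positive determinant zeros (verbatim the packaging inside `exists_static_definite_tridiagonal_pump`,
for any size). [bookkeeping] -/
theorem exists_typed_of_alternation (n N : ℕ) (ev : ℕ → ℕ) (b : ℕ → ℝ) (f : ℕ → ℕ) (Λ : List ℝ)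
    (hincr : Λ.IsChain (· < ·)) (hpos : ∀ u ∈ Λ, 0 < u) (hlen : N + 1 ≤ Λ.length)
    (halt : Λ.IsChain (fun u v => (((ctPath (fun t => (X : ℝ[X]) ^ ev t) (fun t => C (b t) * X ^ f t) (fun t => C (b (t - 1)) * X ^ f (t - 1)) n)).det).eval u * (((ctPath (fun t => (X : ℝ[X]) ^ ev t) (fun t => C (b t) * X ^ f t) (fun t => C (b (t - 1)) * X ^ f (t - 1)) n)).det).eval v < 0)) :
    ∃ (c : Fin n → Fin n → ℝ) (e : Fin n → Fin n → ℕ),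
      (∀ i j, c i j = c j i) ∧ (∀ i j, e i j = e j i) ∧
      (∀ i j : Fin n, (i : ℕ) + 1 < j ∨ (j : ℕ) + 1 < i → c i j = 0) ∧ (∀ i, 0 < c i i) ∧
      N ≤ ((Matrix.det (Matrix.of fun i j => C (c i j) * (X : ℝ[X]) ^ e i j)).roots.toFinset.filter
        (fun t : ℝ => 0 < t)).card := by
  refine ⟨fun i j => if (j : ℕ) = i then 1 else if (j : ℕ) = i + 1 then b i else if (i : ℕ) = j + 1 then b j else 0,
    fun i j => if (j : ℕ) = i then ev i else if (j : ℕ) = i + 1 then f i else if (i : ℕ) = j + 1 then f j else 0,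
    ?_, ?_, ?_, ?_, ?_⟩
  · intro i j
    dsimp only
    split_ifs <;> first | rfl | (exfalso; omega)
  · intro i j
    dsimp only
    split_ifs <;> first | rfl | (exfalso; omega) | congr 1
  · intro i j hij
    dsimp only
    split_ifs <;> first | rfl | (exfalso; omega)
  · intro i; simp
  · have hM : (Matrix.of fun i j : Fin n =>
        C ((if (j : ℕ) = i then 1 else if (j : ℕ) = i + 1 then b i else if (i : ℕ) = j + 1 then b j else 0 : ℝ)) *
          (X : ℝ[X]) ^ (if (j : ℕ) = i then ev i else if (j : ℕ) = i + 1 then f i else if (i : ℕ) = j + 1 then f j else 0 : ℕ)) =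
        (ctPath (fun t => (X : ℝ[X]) ^ ev t) (fun t => C (b t) * X ^ f t) (fun t => C (b (t - 1)) * X ^ f (t - 1)) n) := by
      ext i j
      simp only [Matrix.of_apply, ctPath_apply]
      split_ifs with h1 h2 h3
      · simp
      · rfl
      · have : (i : ℕ) - 1 = j := by omega
        rw [this]
      · simp
    rw [hM]
    have hcount := le_card_posRoots_of_isChain ((ctPath (fun t => (X : ℝ[X]) ^ ev t) (fun t => C (b t) * X ^ f t) (fun t => C (b (t - 1)) * X ^ f (t - 1)) n)).det Λ hincr hpos halt
    omega

/-! ### The seeded pump in the typed currency -/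

/-- **THE SEEDED PUMP**: a certified seed — the 17-clause invariant for `(z ↦ D_{k+3}(ρz), z ↦ D_{k+4}(ρz))` of a design with unit diagonal
coefficients, `ρ = ±1`, `μ = −ρs`, positive actual points, `|R| + |T| = S` — gives for every `j` a STATIC DEFINITE symmetric tridiagonal
`(k+j+5) × (k+j+5)` monomial matrix of the typed currency with at least `S + 2j + 2` distinct positive determinant zeros: `j` pump moves, then the
harvest.  In the register's words: a seed of size `m₀ = k + 4` with value `S` gives `B m ≥ 2m + S − 2m₀` for all `m > m₀`.
[mechanism: val-sym-lift-p3 g9's pump-and-harvest; folklore] -/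
theorem row_of_seed (k S : ℕ) {e : ℕ → ℕ} {b : ℕ → ℝ} {f : ℕ → ℕ} {ρ s μ P0 x x₁ : ℝ} {R : List ℝ} {M : ℝ} {T : List ℝ} {y y₁ P1 : ℝ}
    (hρ : ρ = 1 ∨ ρ = -1) (hμ : μ = -(ρ * s)) (hρP0 : 0 < ρ * P0) (hρP1 : 0 < ρ * P1) (hlen : R.length + T.length = S)
    (c1 : (P0 :: x :: x₁ :: (R ++ M :: (T ++ [y, y₁, P1]))).IsChain (· < ·))
    (c2a : 0 < s * (fun z : ℝ => (((ctPath (fun t => (X : ℝ[X]) ^ e t) (fun t => C (b t) * X ^ f t) (fun t => C (b (t - 1)) * X ^ f (t - 1)) (k + 4))).det).eval (ρ * z)) P0)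
    (c2b : s * (fun z : ℝ => (((ctPath (fun t => (X : ℝ[X]) ^ e t) (fun t => C (b t) * X ^ f t) (fun t => C (b (t - 1)) * X ^ f (t - 1)) (k + 4))).det).eval (ρ * z)) x < 0)
    (c2c : s * (fun z : ℝ => (((ctPath (fun t => (X : ℝ[X]) ^ e t) (fun t => C (b t) * X ^ f t) (fun t => C (b (t - 1)) * X ^ f (t - 1)) (k + 4))).det).eval (ρ * z)) x₁ < 0)
    (c2d : (∀ r ∈ R, s * (fun z : ℝ => (((ctPath (fun t => (X : ℝ[X]) ^ e t) (fun t => C (b t) * X ^ f t) (fun t => C (b (t - 1)) * X ^ f (t - 1)) (k + 4))).det).eval (ρ * z)) r < 0))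
    (c2e : s * (fun z : ℝ => (((ctPath (fun t => (X : ℝ[X]) ^ e t) (fun t => C (b t) * X ^ f t) (fun t => C (b (t - 1)) * X ^ f (t - 1)) (k + 4))).det).eval (ρ * z)) M < 0)
    (c2f : (M :: (T ++ [y])).IsChain (fun u v => (fun z : ℝ => (((ctPath (fun t => (X : ℝ[X]) ^ e t) (fun t => C (b t) * X ^ f t) (fun t => C (b (t - 1)) * X ^ f (t - 1)) (k + 4))).det).eval (ρ * z)) u * (fun z : ℝ => (((ctPath (fun t => (X : ℝ[X]) ^ e t) (fun t => C (b t) * X ^ f t) (fun t => C (b (t - 1)) * X ^ f (t - 1)) (k + 4))).det).eval (ρ * z)) v < 0))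
    (c2g : μ * (fun z : ℝ => (((ctPath (fun t => (X : ℝ[X]) ^ e t) (fun t => C (b t) * X ^ f t) (fun t => C (b (t - 1)) * X ^ f (t - 1)) (k + 4))).det).eval (ρ * z)) y < 0)
    (c3c : s * (fun z : ℝ => (((ctPath (fun t => (X : ℝ[X]) ^ e t) (fun t => C (b t) * X ^ f t) (fun t => C (b (t - 1)) * X ^ f (t - 1)) (k + 3))).det).eval (ρ * z)) x₁ < 0)
    (c3d : (x₁ :: (R ++ [M])).IsChain (fun u v => (fun z : ℝ => (((ctPath (fun t => (X : ℝ[X]) ^ e t) (fun t => C (b t) * X ^ f t) (fun t => C (b (t - 1)) * X ^ f (t - 1)) (k + 3))).det).eval (ρ * z)) u * (fun z : ℝ => (((ctPath (fun t => (X : ℝ[X]) ^ e t) (fun t => C (b t) * X ^ f t) (fun t => C (b (t - 1)) * X ^ f (t - 1)) (k + 3))).det).eval (ρ * z)) v < 0))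
    (c3e : 0 < μ * (fun z : ℝ => (((ctPath (fun t => (X : ℝ[X]) ^ e t) (fun t => C (b t) * X ^ f t) (fun t => C (b (t - 1)) * X ^ f (t - 1)) (k + 3))).det).eval (ρ * z)) M)
    (c3f : (∀ t ∈ T, 0 < μ * (fun z : ℝ => (((ctPath (fun t => (X : ℝ[X]) ^ e t) (fun t => C (b t) * X ^ f t) (fun t => C (b (t - 1)) * X ^ f (t - 1)) (k + 3))).det).eval (ρ * z)) t))
    (c3g : 0 < μ * (fun z : ℝ => (((ctPath (fun t => (X : ℝ[X]) ^ e t) (fun t => C (b t) * X ^ f t) (fun t => C (b (t - 1)) * X ^ f (t - 1)) (k + 3))).det).eval (ρ * z)) y)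
    (c3h : 0 < μ * (fun z : ℝ => (((ctPath (fun t => (X : ℝ[X]) ^ e t) (fun t => C (b t) * X ^ f t) (fun t => C (b (t - 1)) * X ^ f (t - 1)) (k + 3))).det).eval (ρ * z)) y₁)
    (c3i : μ * (fun z : ℝ => (((ctPath (fun t => (X : ℝ[X]) ^ e t) (fun t => C (b t) * X ^ f t) (fun t => C (b (t - 1)) * X ^ f (t - 1)) (k + 3))).det).eval (ρ * z)) P1 < 0)
    (c4 : (∀ z ∈ Set.Icc P0 x₁, s * (fun z : ℝ => (((ctPath (fun t => (X : ℝ[X]) ^ e t) (fun t => C (b t) * X ^ f t) (fun t => C (b (t - 1)) * X ^ f (t - 1)) (k + 3))).det).eval (ρ * z)) z < 0))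
    (c5 : (∀ z ∈ Set.Icc y P1, μ * (fun z : ℝ => (((ctPath (fun t => (X : ℝ[X]) ^ e t) (fun t => C (b t) * X ^ f t) (fun t => C (b (t - 1)) * X ^ f (t - 1)) (k + 4))).det).eval (ρ * z)) z < 0)) (j : ℕ) :
    ∃ (c : Fin (k + j + 5) → Fin (k + j + 5) → ℝ) (e' : Fin (k + j + 5) → Fin (k + j + 5) → ℕ),
      (∀ i j, c i j = c j i) ∧ (∀ i j, e' i j = e' j i) ∧
      (∀ i j : Fin (k + j + 5), (i : ℕ) + 1 < j ∨ (j : ℕ) + 1 < i → c i j = 0) ∧ (∀ i, 0 < c i i) ∧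
      S + 2 * j + 2 ≤ ((Matrix.det (Matrix.of fun i j => C (c i j) * (X : ℝ[X]) ^ e' i j)).roots.toFinset.filter
        (fun t : ℝ => 0 < t)).card := by
  obtain ⟨e₁, b₁, f₁, ρ₁, s₁, μ₁, Q0, u, u₁, R₁, M₁, T₁, v, v₁, Q1, hρ₁, hμ₁, hQ0, hQ1, hlen₁,
    d1, d2a, d2b, d2c, d2d, d2e, d2f, d2g, d3c, d3d, d3e, d3f, d3g, d3h, d3i, d4, d5⟩ :=
    pump_moves k S hρ hμ hρP0 hρP1 hlen c1 c2a c2b c2c c2d c2e c2f c2g c3c c3d c3e c3f c3g c3h c3i c4 c5 j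
  have hρ₁' : ρ₁ = 1 ∨ ρ₁ = -1 := by
    rcases hρ with h | h <;> rcases neg_one_pow_eq_or ℝ j with hj | hj <;> simp [hρ₁, h, hj]
  obtain ⟨e₂, b₂, f₂, Λ, hincr, hpos, hl, -, halt⟩ :=
    harvest_of_state (k + j) (S + 2 * j) hρ₁' hμ₁ hQ0 hQ1 hlen₁ d1 d2a d2b d2c d2d d2e d2f d2g d3c d3d d3e d3f d3g d3h d3i d4 d5
  exact exists_typed_of_alternation (k + j + 5) (S + 2 * j + 2) e₂ b₂ f₂ Λ hincr hpos (by omega) halt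

/-- **THE SEEDED PUMP, POSITIVE ORIENTATION**: when `(−1)^j ρ = 1` (every other `j`) the harvest meets a transition zero at the junction and the
matrix of `row_of_seed` has at least `S + 2j + 3` distinct positive determinant zeros. [mechanism: val-sym-lift-p3 g9's pump-and-harvest; folklore] -/
theorem row_of_seed_pos (k S : ℕ) {e : ℕ → ℕ} {b : ℕ → ℝ} {f : ℕ → ℕ} {ρ s μ P0 x x₁ : ℝ} {R : List ℝ} {M : ℝ} {T : List ℝ} {y y₁ P1 : ℝ}
    (hρ : ρ = 1 ∨ ρ = -1) (hμ : μ = -(ρ * s)) (hρP0 : 0 < ρ * P0) (hρP1 : 0 < ρ * P1) (hlen : R.length + T.length = S)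
    (c1 : (P0 :: x :: x₁ :: (R ++ M :: (T ++ [y, y₁, P1]))).IsChain (· < ·))
    (c2a : 0 < s * (fun z : ℝ => (((ctPath (fun t => (X : ℝ[X]) ^ e t) (fun t => C (b t) * X ^ f t) (fun t => C (b (t - 1)) * X ^ f (t - 1)) (k + 4))).det).eval (ρ * z)) P0)
    (c2b : s * (fun z : ℝ => (((ctPath (fun t => (X : ℝ[X]) ^ e t) (fun t => C (b t) * X ^ f t) (fun t => C (b (t - 1)) * X ^ f (t - 1)) (k + 4))).det).eval (ρ * z)) x < 0)
    (c2c : s * (fun z : ℝ => (((ctPath (fun t => (X : ℝ[X]) ^ e t) (fun t => C (b t) * X ^ f t) (fun t => C (b (t - 1)) * X ^ f (t - 1)) (k + 4))).det).eval (ρ * z)) x₁ < 0)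
    (c2d : (∀ r ∈ R, s * (fun z : ℝ => (((ctPath (fun t => (X : ℝ[X]) ^ e t) (fun t => C (b t) * X ^ f t) (fun t => C (b (t - 1)) * X ^ f (t - 1)) (k + 4))).det).eval (ρ * z)) r < 0))
    (c2e : s * (fun z : ℝ => (((ctPath (fun t => (X : ℝ[X]) ^ e t) (fun t => C (b t) * X ^ f t) (fun t => C (b (t - 1)) * X ^ f (t - 1)) (k + 4))).det).eval (ρ * z)) M < 0)
    (c2f : (M :: (T ++ [y])).IsChain (fun u v => (fun z : ℝ => (((ctPath (fun t => (X : ℝ[X]) ^ e t) (fun t => C (b t) * X ^ f t) (fun t => C (b (t - 1)) * X ^ f (t - 1)) (k + 4))).det).eval (ρ * z)) u * (fun z : ℝ => (((ctPath (fun t => (X : ℝ[X]) ^ e t) (fun t => C (b t) * X ^ f t) (fun t => C (b (t - 1)) * X ^ f (t - 1)) (k + 4))).det).eval (ρ * z)) v < 0))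
    (c2g : μ * (fun z : ℝ => (((ctPath (fun t => (X : ℝ[X]) ^ e t) (fun t => C (b t) * X ^ f t) (fun t => C (b (t - 1)) * X ^ f (t - 1)) (k + 4))).det).eval (ρ * z)) y < 0)
    (c3c : s * (fun z : ℝ => (((ctPath (fun t => (X : ℝ[X]) ^ e t) (fun t => C (b t) * X ^ f t) (fun t => C (b (t - 1)) * X ^ f (t - 1)) (k + 3))).det).eval (ρ * z)) x₁ < 0)
    (c3d : (x₁ :: (R ++ [M])).IsChain (fun u v => (fun z : ℝ => (((ctPath (fun t => (X : ℝ[X]) ^ e t) (fun t => C (b t) * X ^ f t) (fun t => C (b (t - 1)) * X ^ f (t - 1)) (k + 3))).det).eval (ρ * z)) u * (fun z : ℝ => (((ctPath (fun t => (X : ℝ[X]) ^ e t) (fun t => C (b t) * X ^ f t) (fun t => C (b (t - 1)) * X ^ f (t - 1)) (k + 3))).det).eval (ρ * z)) v < 0))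
    (c3e : 0 < μ * (fun z : ℝ => (((ctPath (fun t => (X : ℝ[X]) ^ e t) (fun t => C (b t) * X ^ f t) (fun t => C (b (t - 1)) * X ^ f (t - 1)) (k + 3))).det).eval (ρ * z)) M)
    (c3f : (∀ t ∈ T, 0 < μ * (fun z : ℝ => (((ctPath (fun t => (X : ℝ[X]) ^ e t) (fun t => C (b t) * X ^ f t) (fun t => C (b (t - 1)) * X ^ f (t - 1)) (k + 3))).det).eval (ρ * z)) t))
    (c3g : 0 < μ * (fun z : ℝ => (((ctPath (fun t => (X : ℝ[X]) ^ e t) (fun t => C (b t) * X ^ f t) (fun t => C (b (t - 1)) * X ^ f (t - 1)) (k + 3))).det).eval (ρ * z)) y)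
    (c3h : 0 < μ * (fun z : ℝ => (((ctPath (fun t => (X : ℝ[X]) ^ e t) (fun t => C (b t) * X ^ f t) (fun t => C (b (t - 1)) * X ^ f (t - 1)) (k + 3))).det).eval (ρ * z)) y₁)
    (c3i : μ * (fun z : ℝ => (((ctPath (fun t => (X : ℝ[X]) ^ e t) (fun t => C (b t) * X ^ f t) (fun t => C (b (t - 1)) * X ^ f (t - 1)) (k + 3))).det).eval (ρ * z)) P1 < 0)
    (c4 : (∀ z ∈ Set.Icc P0 x₁, s * (fun z : ℝ => (((ctPath (fun t => (X : ℝ[X]) ^ e t) (fun t => C (b t) * X ^ f t) (fun t => C (b (t - 1)) * X ^ f (t - 1)) (k + 3))).det).eval (ρ * z)) z < 0))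
    (c5 : (∀ z ∈ Set.Icc y P1, μ * (fun z : ℝ => (((ctPath (fun t => (X : ℝ[X]) ^ e t) (fun t => C (b t) * X ^ f t) (fun t => C (b (t - 1)) * X ^ f (t - 1)) (k + 4))).det).eval (ρ * z)) z < 0)) (j : ℕ) (hj : (-1 : ℝ) ^ j * ρ = 1) :
    ∃ (c : Fin (k + j + 5) → Fin (k + j + 5) → ℝ) (e' : Fin (k + j + 5) → Fin (k + j + 5) → ℕ),
      (∀ i j, c i j = c j i) ∧ (∀ i j, e' i j = e' j i) ∧
      (∀ i j : Fin (k + j + 5), (i : ℕ) + 1 < j ∨ (j : ℕ) + 1 < i → c i j = 0) ∧ (∀ i, 0 < c i i) ∧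
      S + 2 * j + 3 ≤ ((Matrix.det (Matrix.of fun i j => C (c i j) * (X : ℝ[X]) ^ e' i j)).roots.toFinset.filter
        (fun t : ℝ => 0 < t)).card := by
  obtain ⟨e₁, b₁, f₁, ρ₁, s₁, μ₁, Q0, u, u₁, R₁, M₁, T₁, v, v₁, Q1, hρ₁, hμ₁, hQ0, hQ1, hlen₁,
    d1, d2a, d2b, d2c, d2d, d2e, d2f, d2g, d3c, d3d, d3e, d3f, d3g, d3h, d3i, d4, d5⟩ :=
    pump_moves k S hρ hμ hρP0 hρP1 hlen c1 c2a c2b c2c c2d c2e c2f c2g c3c c3d c3e c3f c3g c3h c3i c4 c5 j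
  have hρ₁1 : ρ₁ = 1 := by rw [hρ₁, hj]
  obtain ⟨e₂, b₂, f₂, Λ, hincr, hpos, -, hl4, halt⟩ :=
    harvest_of_state (k + j) (S + 2 * j) (Or.inl hρ₁1) hμ₁ hQ0 hQ1 hlen₁ d1 d2a d2b d2c d2d d2e d2f d2g d3c d3d d3e d3f d3g d3h d3i d4 d5
  exact exists_typed_of_alternation (k + j + 5) (S + 2 * j + 3) e₂ b₂ f₂ Λ hincr hpos (by have := hl4 hρ₁1; omega) halt

/-- **Seeds against laws**: every admissible law `B` of the static definite tridiagonal sector has `S + 2j + 2 ≤ B (k + j + 5)` for all `j` once a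
seed `(k, S, ρ)` is certified. [corollary] -/
theorem le_law_of_seed (k S : ℕ) {e : ℕ → ℕ} {b : ℕ → ℝ} {f : ℕ → ℕ} {ρ s μ P0 x x₁ : ℝ} {R : List ℝ} {M : ℝ} {T : List ℝ} {y y₁ P1 : ℝ}
    (hρ : ρ = 1 ∨ ρ = -1) (hμ : μ = -(ρ * s)) (hρP0 : 0 < ρ * P0) (hρP1 : 0 < ρ * P1) (hlen : R.length + T.length = S)
    (c1 : (P0 :: x :: x₁ :: (R ++ M :: (T ++ [y, y₁, P1]))).IsChain (· < ·))
    (c2a : 0 < s * (fun z : ℝ => (((ctPath (fun t => (X : ℝ[X]) ^ e t) (fun t => C (b t) * X ^ f t) (fun t => C (b (t - 1)) * X ^ f (t - 1)) (k + 4))).det).eval (ρ * z)) P0)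
    (c2b : s * (fun z : ℝ => (((ctPath (fun t => (X : ℝ[X]) ^ e t) (fun t => C (b t) * X ^ f t) (fun t => C (b (t - 1)) * X ^ f (t - 1)) (k + 4))).det).eval (ρ * z)) x < 0)
    (c2c : s * (fun z : ℝ => (((ctPath (fun t => (X : ℝ[X]) ^ e t) (fun t => C (b t) * X ^ f t) (fun t => C (b (t - 1)) * X ^ f (t - 1)) (k + 4))).det).eval (ρ * z)) x₁ < 0)
    (c2d : (∀ r ∈ R, s * (fun z : ℝ => (((ctPath (fun t => (X : ℝ[X]) ^ e t) (fun t => C (b t) * X ^ f t) (fun t => C (b (t - 1)) * X ^ f (t - 1)) (k + 4))).det).eval (ρ * z)) r < 0))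
    (c2e : s * (fun z : ℝ => (((ctPath (fun t => (X : ℝ[X]) ^ e t) (fun t => C (b t) * X ^ f t) (fun t => C (b (t - 1)) * X ^ f (t - 1)) (k + 4))).det).eval (ρ * z)) M < 0)
    (c2f : (M :: (T ++ [y])).IsChain (fun u v => (fun z : ℝ => (((ctPath (fun t => (X : ℝ[X]) ^ e t) (fun t => C (b t) * X ^ f t) (fun t => C (b (t - 1)) * X ^ f (t - 1)) (k + 4))).det).eval (ρ * z)) u * (fun z : ℝ => (((ctPath (fun t => (X : ℝ[X]) ^ e t) (fun t => C (b t) * X ^ f t) (fun t => C (b (t - 1)) * X ^ f (t - 1)) (k + 4))).det).eval (ρ * z)) v < 0))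
    (c2g : μ * (fun z : ℝ => (((ctPath (fun t => (X : ℝ[X]) ^ e t) (fun t => C (b t) * X ^ f t) (fun t => C (b (t - 1)) * X ^ f (t - 1)) (k + 4))).det).eval (ρ * z)) y < 0)
    (c3c : s * (fun z : ℝ => (((ctPath (fun t => (X : ℝ[X]) ^ e t) (fun t => C (b t) * X ^ f t) (fun t => C (b (t - 1)) * X ^ f (t - 1)) (k + 3))).det).eval (ρ * z)) x₁ < 0)
    (c3d : (x₁ :: (R ++ [M])).IsChain (fun u v => (fun z : ℝ => (((ctPath (fun t => (X : ℝ[X]) ^ e t) (fun t => C (b t) * X ^ f t) (fun t => C (b (t - 1)) * X ^ f (t - 1)) (k + 3))).det).eval (ρ * z)) u * (fun z : ℝ => (((ctPath (fun t => (X : ℝ[X]) ^ e t) (fun t => C (b t) * X ^ f t) (fun t => C (b (t - 1)) * X ^ f (t - 1)) (k + 3))).det).eval (ρ * z)) v < 0))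
    (c3e : 0 < μ * (fun z : ℝ => (((ctPath (fun t => (X : ℝ[X]) ^ e t) (fun t => C (b t) * X ^ f t) (fun t => C (b (t - 1)) * X ^ f (t - 1)) (k + 3))).det).eval (ρ * z)) M)
    (c3f : (∀ t ∈ T, 0 < μ * (fun z : ℝ => (((ctPath (fun t => (X : ℝ[X]) ^ e t) (fun t => C (b t) * X ^ f t) (fun t => C (b (t - 1)) * X ^ f (t - 1)) (k + 3))).det).eval (ρ * z)) t))
    (c3g : 0 < μ * (fun z : ℝ => (((ctPath (fun t => (X : ℝ[X]) ^ e t) (fun t => C (b t) * X ^ f t) (fun t => C (b (t - 1)) * X ^ f (t - 1)) (k + 3))).det).eval (ρ * z)) y)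
    (c3h : 0 < μ * (fun z : ℝ => (((ctPath (fun t => (X : ℝ[X]) ^ e t) (fun t => C (b t) * X ^ f t) (fun t => C (b (t - 1)) * X ^ f (t - 1)) (k + 3))).det).eval (ρ * z)) y₁)
    (c3i : μ * (fun z : ℝ => (((ctPath (fun t => (X : ℝ[X]) ^ e t) (fun t => C (b t) * X ^ f t) (fun t => C (b (t - 1)) * X ^ f (t - 1)) (k + 3))).det).eval (ρ * z)) P1 < 0)
    (c4 : (∀ z ∈ Set.Icc P0 x₁, s * (fun z : ℝ => (((ctPath (fun t => (X : ℝ[X]) ^ e t) (fun t => C (b t) * X ^ f t) (fun t => C (b (t - 1)) * X ^ f (t - 1)) (k + 3))).det).eval (ρ * z)) z < 0))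
    (c5 : (∀ z ∈ Set.Icc y P1, μ * (fun z : ℝ => (((ctPath (fun t => (X : ℝ[X]) ^ e t) (fun t => C (b t) * X ^ f t) (fun t => C (b (t - 1)) * X ^ f (t - 1)) (k + 4))).det).eval (ρ * z)) z < 0)) (B : ℕ → ℕ)
    (hB : ∀ (m : ℕ) (c : Fin m → Fin m → ℝ) (e : Fin m → Fin m → ℕ), (∀ i j, c i j = c j i) → (∀ i j, e i j = e j i) →
        (∀ i j : Fin m, (i : ℕ) + 1 < j ∨ (j : ℕ) + 1 < i → c i j = 0) → (∀ i, 0 < c i i) →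
        ((Matrix.det (Matrix.of fun i j => C (c i j) * (X : ℝ[X]) ^ e i j)).roots.toFinset.filter
          (fun t : ℝ => 0 < t)).card ≤ B m)
    (j : ℕ) : S + 2 * j + 2 ≤ B (k + j + 5) := by
  obtain ⟨c, e', hc, he, hband, hpos, hcard⟩ :=
    row_of_seed k S hρ hμ hρP0 hρP1 hlen c1 c2a c2b c2c c2d c2e c2f c2g c3c c3d c3e c3f c3g c3h c3i c4 c5 j
  exact hcard.trans (hB _ c e' hc he hband hpos)

/-- **Seeds against laws, positive orientation**: `S + 2j + 3 ≤ B (k + j + 5)` whenever `(−1)^j ρ = 1`. [corollary] -/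
theorem le_law_of_seed_pos (k S : ℕ) {e : ℕ → ℕ} {b : ℕ → ℝ} {f : ℕ → ℕ} {ρ s μ P0 x x₁ : ℝ} {R : List ℝ} {M : ℝ} {T : List ℝ} {y y₁ P1 : ℝ}
    (hρ : ρ = 1 ∨ ρ = -1) (hμ : μ = -(ρ * s)) (hρP0 : 0 < ρ * P0) (hρP1 : 0 < ρ * P1) (hlen : R.length + T.length = S)
    (c1 : (P0 :: x :: x₁ :: (R ++ M :: (T ++ [y, y₁, P1]))).IsChain (· < ·))
    (c2a : 0 < s * (fun z : ℝ => (((ctPath (fun t => (X : ℝ[X]) ^ e t) (fun t => C (b t) * X ^ f t) (fun t => C (b (t - 1)) * X ^ f (t - 1)) (k + 4))).det).eval (ρ * z)) P0)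
    (c2b : s * (fun z : ℝ => (((ctPath (fun t => (X : ℝ[X]) ^ e t) (fun t => C (b t) * X ^ f t) (fun t => C (b (t - 1)) * X ^ f (t - 1)) (k + 4))).det).eval (ρ * z)) x < 0)
    (c2c : s * (fun z : ℝ => (((ctPath (fun t => (X : ℝ[X]) ^ e t) (fun t => C (b t) * X ^ f t) (fun t => C (b (t - 1)) * X ^ f (t - 1)) (k + 4))).det).eval (ρ * z)) x₁ < 0)
    (c2d : (∀ r ∈ R, s * (fun z : ℝ => (((ctPath (fun t => (X : ℝ[X]) ^ e t) (fun t => C (b t) * X ^ f t) (fun t => C (b (t - 1)) * X ^ f (t - 1)) (k + 4))).det).eval (ρ * z)) r < 0))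
    (c2e : s * (fun z : ℝ => (((ctPath (fun t => (X : ℝ[X]) ^ e t) (fun t => C (b t) * X ^ f t) (fun t => C (b (t - 1)) * X ^ f (t - 1)) (k + 4))).det).eval (ρ * z)) M < 0)
    (c2f : (M :: (T ++ [y])).IsChain (fun u v => (fun z : ℝ => (((ctPath (fun t => (X : ℝ[X]) ^ e t) (fun t => C (b t) * X ^ f t) (fun t => C (b (t - 1)) * X ^ f (t - 1)) (k + 4))).det).eval (ρ * z)) u * (fun z : ℝ => (((ctPath (fun t => (X : ℝ[X]) ^ e t) (fun t => C (b t) * X ^ f t) (fun t => C (b (t - 1)) * X ^ f (t - 1)) (k + 4))).det).eval (ρ * z)) v < 0))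
    (c2g : μ * (fun z : ℝ => (((ctPath (fun t => (X : ℝ[X]) ^ e t) (fun t => C (b t) * X ^ f t) (fun t => C (b (t - 1)) * X ^ f (t - 1)) (k + 4))).det).eval (ρ * z)) y < 0)
    (c3c : s * (fun z : ℝ => (((ctPath (fun t => (X : ℝ[X]) ^ e t) (fun t => C (b t) * X ^ f t) (fun t => C (b (t - 1)) * X ^ f (t - 1)) (k + 3))).det).eval (ρ * z)) x₁ < 0)
    (c3d : (x₁ :: (R ++ [M])).IsChain (fun u v => (fun z : ℝ => (((ctPath (fun t => (X : ℝ[X]) ^ e t) (fun t => C (b t) * X ^ f t) (fun t => C (b (t - 1)) * X ^ f (t - 1)) (k + 3))).det).eval (ρ * z)) u * (fun z : ℝ => (((ctPath (fun t => (X : ℝ[X]) ^ e t) (fun t => C (b t) * X ^ f t) (fun t => C (b (t - 1)) * X ^ f (t - 1)) (k + 3))).det).eval (ρ * z)) v < 0))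
    (c3e : 0 < μ * (fun z : ℝ => (((ctPath (fun t => (X : ℝ[X]) ^ e t) (fun t => C (b t) * X ^ f t) (fun t => C (b (t - 1)) * X ^ f (t - 1)) (k + 3))).det).eval (ρ * z)) M)
    (c3f : (∀ t ∈ T, 0 < μ * (fun z : ℝ => (((ctPath (fun t => (X : ℝ[X]) ^ e t) (fun t => C (b t) * X ^ f t) (fun t => C (b (t - 1)) * X ^ f (t - 1)) (k + 3))).det).eval (ρ * z)) t))
    (c3g : 0 < μ * (fun z : ℝ => (((ctPath (fun t => (X : ℝ[X]) ^ e t) (fun t => C (b t) * X ^ f t) (fun t => C (b (t - 1)) * X ^ f (t - 1)) (k + 3))).det).eval (ρ * z)) y)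
    (c3h : 0 < μ * (fun z : ℝ => (((ctPath (fun t => (X : ℝ[X]) ^ e t) (fun t => C (b t) * X ^ f t) (fun t => C (b (t - 1)) * X ^ f (t - 1)) (k + 3))).det).eval (ρ * z)) y₁)
    (c3i : μ * (fun z : ℝ => (((ctPath (fun t => (X : ℝ[X]) ^ e t) (fun t => C (b t) * X ^ f t) (fun t => C (b (t - 1)) * X ^ f (t - 1)) (k + 3))).det).eval (ρ * z)) P1 < 0)
    (c4 : (∀ z ∈ Set.Icc P0 x₁, s * (fun z : ℝ => (((ctPath (fun t => (X : ℝ[X]) ^ e t) (fun t => C (b t) * X ^ f t) (fun t => C (b (t - 1)) * X ^ f (t - 1)) (k + 3))).det).eval (ρ * z)) z < 0))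
    (c5 : (∀ z ∈ Set.Icc y P1, μ * (fun z : ℝ => (((ctPath (fun t => (X : ℝ[X]) ^ e t) (fun t => C (b t) * X ^ f t) (fun t => C (b (t - 1)) * X ^ f (t - 1)) (k + 4))).det).eval (ρ * z)) z < 0)) (B : ℕ → ℕ)
    (hB : ∀ (m : ℕ) (c : Fin m → Fin m → ℝ) (e : Fin m → Fin m → ℕ), (∀ i j, c i j = c j i) → (∀ i j, e i j = e j i) →
        (∀ i j : Fin m, (i : ℕ) + 1 < j ∨ (j : ℕ) + 1 < i → c i j = 0) → (∀ i, 0 < c i i) →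
        ((Matrix.det (Matrix.of fun i j => C (c i j) * (X : ℝ[X]) ^ e i j)).roots.toFinset.filter
          (fun t : ℝ => 0 < t)).card ≤ B m)
    (j : ℕ) (hj : (-1 : ℝ) ^ j * ρ = 1) : S + 2 * j + 3 ≤ B (k + j + 5) := by
  obtain ⟨c, e', hc, he, hband, hpos, hcard⟩ :=
    row_of_seed_pos k S hρ hμ hρP0 hρP1 hlen c1 c2a c2b c2c c2d c2e c2f c2g c3c c3d c3e c3f c3g c3h c3i c4 c5 j hj
  exact hcard.trans (hB _ c e' hc he hband hpos)

/-! ### The tree's pump as the seed `(k, S, ρ) = (0, 1, −1)` -/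

/-- **The pump of record is the seeded pump from `pump_base₀`**: every admissible law has `2j + 3 ≤ B (j + 5)` and, for odd `j`,
`2j + 4 ≤ B (j + 5)` — `B m ≥ 2m − 7` for all `m ≥ 5` and `≥ 2m − 6` for even `m ≥ 6` (the rows of `…Pump` / `…PumpEven`), here obtained by
feeding the base state (`|R| + |T| = 1`, orientation `−1`, size `4`) to `le_law_of_seed` / `le_law_of_seed_pos`. [corollary; usage check] -/
theorem le_law_of_pump_base (B : ℕ → ℕ)
    (hB : ∀ (m : ℕ) (c : Fin m → Fin m → ℝ) (e : Fin m → Fin m → ℕ), (∀ i j, c i j = c j i) → (∀ i j, e i j = e j i) →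
        (∀ i j : Fin m, (i : ℕ) + 1 < j ∨ (j : ℕ) + 1 < i → c i j = 0) → (∀ i, 0 < c i i) →
        ((Matrix.det (Matrix.of fun i j => C (c i j) * (X : ℝ[X]) ^ e i j)).roots.toFinset.filter
          (fun t : ℝ => 0 < t)).card ≤ B m)
    (j : ℕ) : 2 * j + 3 ≤ B (j + 5) ∧ (Odd j → 2 * j + 4 ≤ B (j + 5)) := by
  obtain ⟨c1, c2a, c2b, c2c, c2d, c2e, c2f, c2g, c3c, c3d, c3e, c3f, c3g, c3h, c3i, c4, c5⟩ := pump_base₀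
  refine ⟨?_, fun hj => ?_⟩
  · have h := le_law_of_seed 0 1 (ρ := -1) (s := 1) (μ := 1) (Or.inr rfl) (by norm_num) (by norm_num) (by norm_num) (by simp)
      c1 c2a c2b c2c c2d c2e c2f c2g c3c c3d c3e c3f c3g c3h c3i c4 c5 B hB j
    rw [Nat.zero_add] at h
    omega
  · have h := le_law_of_seed_pos 0 1 (ρ := -1) (s := 1) (μ := 1) (Or.inr rfl) (by norm_num) (by norm_num) (by norm_num) (by simp)
      c1 c2a c2b c2c c2d c2e c2f c2g c3c c3d c3e c3f c3g c3h c3i c4 c5 B hB j (by rw [hj.neg_one_pow]; norm_num)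
    rw [Nat.zero_add] at h
    omega

end Summit.ValiantsHypothesis.ValiantsHypothesis.Theorems.KPlusLogSqLaw.StaticTridiagonalRealLadder
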